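import Literature.Analysis.FunctionSpaces.PlancherelL1L2
import Mathlib.Analysis.SpecialFunctions.Trigonometric.Bounds
import Mathlib.Analysis.Fourier.FourierTransformDeriv
import HarnessLib

/-!
# Difference quotients of `L¹ ∩ L²` functions in Fourier space

Topic `Literature/MathematicalPhysics/QuantumManyBody` (provefact
`Literature.MathematicalPhysics.QuantumManyBody.BoseGas.Fournais2020_thm21`). The small-box bound
[Fournais2020, Thm. 2.1] is proved in this topic on **bounded** states
(`Fournais2020_thm21_bdd`, `PeriodicBoseGasBounded.lean`); the passage to all states of the form
domain truncates `Φ ↦ S_k ∘ Φ` (`S_k` the radial projection of `ℂ` onto the disc of radius `k`)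
and needs the continuity of the localised kinetic form
`⟨φ, T_uφ⟩ = ∫ (4π²|p|² - (sℓ)⁻²)₊ |𝓕(χ_u Q_uφ)(p)|² dp + bℓ⁻²‖Q_uφ‖²` (`kinLoc`) under these
truncations. Since `kinLoc` is written in Fourier space while truncation acts pointwise in
physical space, the bridge is the classical difference-quotient description of the `H¹`
seminorm (Beurling–Deny; Lieb–Loss, *Analysis*, Thm. 7.9 and §7.10): for `f ∈ L¹ ∩ L²(V)` and
`h ∈ V`,

* `∫ ‖f(x+h) - f(x)‖² dx = ∫ |e^{2πi⟨h,p⟩} - 1|² ‖𝓕f(p)‖² dp` (Plancherel, the tree's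
  `Literature.Analysis.FunctionSpaces.lintegral_enorm_sq_fourierIntegral_eq`, and
  `𝓕(f(· + h)) = e^{2πi⟨h,·⟩}𝓕f`, Mathlib's `VectorFourier.fourierIntegral_comp_add_right`),
  whence `∫ ‖f(x+h) - f(x)‖² ≤ ∫ (2π⟨h,p⟩)² ‖𝓕f(p)‖² dp` (`lintegral_enorm_sq_translate_sub_le`);
* conversely (Fatou) `∫ (2π⟨e,p⟩)²‖𝓕f‖² ≤ L` as soon as `t⁻²∫‖f(x+te) - f(x)‖² ≤ L + ε` for `t`
  near `0` (`lintegral_sq_inner_mul_fourier_le_of_eventually`);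
* continuity of translation in `L²` (`tendsto_lintegral_enorm_sq_translate_sub`) and the Cauchy
  property of the difference quotients `t⁻¹(f(· + te) - f)` in `L²` as `t → 0` when
  `∫ ⟨e,p⟩²‖𝓕f‖² < ∞` (`tendsto_lintegral_symbolDefect`, `lintegral_enorm_sq_diffQuot_sub_le`),
  both by dominated convergence in Fourier space.

Everything is `ℝ≥0∞`-valued (`∫⁻`), so that no finiteness hypothesis is needed to state it; no
new definitions.

## References

* E. H. Lieb, M. Loss, *Analysis*, 2nd ed., AMS 2001: Thm. 7.9 (Fourier characterisation of
  `H¹`), §7.10.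
* [Fournais2020] S. Fournais, *Length scales for BEC in the dilute Bose gas*, arXiv:2011.00309:
  (2.7), Thm. 2.1.
-/

noncomputable section

open MeasureTheory Filter
open scoped ENNReal NNReal FourierTransform RealInnerProductSpace Topology

namespace Literature.MathematicalPhysics.QuantumManyBody.BoseGas

/-! ### Elementary inequalities -/

/-- `|e^{2πiθ} - 1| ≤ 2π|θ|`. [folklore] -/
theorem norm_fourierChar_sub_one_le (θ : ℝ) : ‖((𝐞 θ : ℂ)) - 1‖ ≤ 2 * Real.pi * |θ| := by
  rw [Real.fourierChar_apply, mul_comm _ Complex.I]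
  refine (Real.norm_exp_I_mul_ofReal_sub_one_le).trans ?_
  rw [Real.norm_eq_abs, abs_mul, abs_of_pos (by positivity : (0:ℝ) < 2 * Real.pi)]

/-- `|e^{2πiθ} - 1| ≤ 2`. [folklore] -/
theorem norm_fourierChar_sub_one_le_two (θ : ℝ) : ‖((𝐞 θ : ℂ)) - 1‖ ≤ 2 := by
  refine (norm_sub_le _ _).trans ?_
  rw [Circle.norm_coe, norm_one]
  norm_num

/-- `‖e^{2πiθ} - 1‖ₑ² ≤ (2πθ)²` in `ℝ≥0∞`. [folklore] -/
theorem enorm_fourierChar_sub_one_sq_le (θ : ℝ) :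
    ‖((𝐞 θ : ℂ)) - 1‖ₑ ^ 2 ≤ ENNReal.ofReal ((2 * Real.pi * θ) ^ 2) := by
  rw [← ofReal_norm, ← ENNReal.ofReal_pow (norm_nonneg _)]
  refine ENNReal.ofReal_le_ofReal ?_
  calc ‖((𝐞 θ : ℂ)) - 1‖ ^ 2 ≤ (2 * Real.pi * |θ|) ^ 2 :=
        pow_le_pow_left₀ (norm_nonneg _) (norm_fourierChar_sub_one_le θ) 2
    _ = (2 * Real.pi * θ) ^ 2 := by rw [mul_pow (2 * Real.pi) |θ|, sq_abs, ← mul_pow]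

/-- `‖e^{2πiθ} - 1‖ₑ² ≤ 4` in `ℝ≥0∞`. [folklore] -/
theorem enorm_fourierChar_sub_one_sq_le_four (θ : ℝ) : ‖((𝐞 θ : ℂ)) - 1‖ₑ ^ 2 ≤ 4 := by
  rw [← ofReal_norm, ← ENNReal.ofReal_pow (norm_nonneg _),
    show (4 : ℝ≥0∞) = ENNReal.ofReal (2 ^ 2) by norm_num]
  exact ENNReal.ofReal_le_ofReal
    (pow_le_pow_left₀ (norm_nonneg _) (norm_fourierChar_sub_one_le_two _) 2)

/-- `‖x - y‖ₑ² ≤ 2‖x - c‖ₑ² + 2‖y - c‖ₑ²`. [folklore] -/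
theorem enorm_sub_sq_le_two_mul {G : Type*} [NormedAddCommGroup G] (x y c : G) :
    ‖x - y‖ₑ ^ 2 ≤ 2 * ‖x - c‖ₑ ^ 2 + 2 * ‖y - c‖ₑ ^ 2 := by
  have h : ‖x - y‖ ^ 2 ≤ 2 * ‖x - c‖ ^ 2 + 2 * ‖y - c‖ ^ 2 := by
    have h1 : ‖x - y‖ ≤ ‖x - c‖ + ‖y - c‖ := by
      calc ‖x - y‖ = ‖(x - c) - (y - c)‖ := by rw [sub_sub_sub_cancel_right]
        _ ≤ ‖x - c‖ + ‖y - c‖ := norm_sub_le _ _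
    have h2 : ‖x - y‖ ^ 2 ≤ (‖x - c‖ + ‖y - c‖) ^ 2 := pow_le_pow_left₀ (norm_nonneg _) h1 2
    nlinarith [sq_nonneg (‖x - c‖ - ‖y - c‖)]
  rw [← ofReal_norm, ← ofReal_norm, ← ofReal_norm, ← ENNReal.ofReal_pow (norm_nonneg _),
    ← ENNReal.ofReal_pow (norm_nonneg _), ← ENNReal.ofReal_pow (norm_nonneg _),
    show (2 : ℝ≥0∞) = ENNReal.ofReal 2 by norm_num, ← ENNReal.ofReal_mul (by norm_num),
    ← ENNReal.ofReal_mul (by norm_num), ← ENNReal.ofReal_add (by positivity) (by positivity)]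
  exact ENNReal.ofReal_le_ofReal h

/-- `‖t⁻¹ • z‖ₑ² = (t²)⁻¹ ‖z‖ₑ²` for `t ≠ 0`. [folklore] -/
theorem enorm_inv_smul_sq {G : Type*} [NormedAddCommGroup G] [NormedSpace ℝ G] {t : ℝ}
    (ht : t ≠ 0) (z : G) :
    ‖(t⁻¹ : ℝ) • z‖ₑ ^ 2 = (ENNReal.ofReal (t ^ 2))⁻¹ * ‖z‖ₑ ^ 2 := by
  rw [enorm_smul, mul_pow, Real.enorm_eq_ofReal_abs, ← ENNReal.ofReal_pow (abs_nonneg _),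
    abs_inv, inv_pow, sq_abs, ENNReal.ofReal_inv_of_pos (by positivity)]

/-- For `f ∈ L²`, `∫ ‖f‖² < ∞`. [folklore] -/
theorem lintegral_enorm_sq_lt_top_of_memLp {α : Type*} [MeasurableSpace α] {μ : Measure α}
    {G : Type*} [NormedAddCommGroup G] {f : α → G} (hf : MemLp f 2 μ) :
    ∫⁻ x, ‖f x‖ₑ ^ 2 ∂μ < ⊤ := by
  have h := lintegral_rpow_enorm_lt_top_of_eLpNorm_lt_top two_ne_zero ENNReal.ofNat_ne_top
    hf.eLpNorm_lt_top
  simp only [ENNReal.toReal_ofNat, ENNReal.rpow_two] at h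
  exact h

variable {V : Type*} [NormedAddCommGroup V] [InnerProductSpace ℝ V] [FiniteDimensional ℝ V]
  [MeasurableSpace V] [BorelSpace V]
variable {E : Type*} [NormedAddCommGroup E] [InnerProductSpace ℂ E] [CompleteSpace E]

/-! ### The Fourier transform of a translate -/

omit [CompleteSpace E] in
/-- `𝓕(f(· + h))(w) = e^{2πi⟨h,w⟩} 𝓕f(w)`. [folklore] -/
theorem fourier_translate (f : V → E) (h w : V) :
    𝓕 (fun x => f (x + h)) w = ((𝐞 (⟪h, w⟫)) : ℂ) • 𝓕 f w := by
  have h2 := congrFun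
    (VectorFourier.fourierIntegral_comp_add_right 𝐞 (volume : Measure V) (innerₗ V) f h) w
  simp only [Function.comp_def] at h2
  rw [show (𝓕 (fun x => f (x + h)) : V → E) =
      VectorFourier.fourierIntegral 𝐞 volume (innerₗ V) (fun x => f (x + h)) from rfl, h2,
    Circle.smul_def]
  rfl

omit [CompleteSpace E] in
/-- `𝓕(f(· + h) - f)(w) = (e^{2πi⟨h,w⟩} - 1) 𝓕f(w)` for integrable `f`. [folklore] -/
theorem fourier_translate_sub {f : V → E} (hf : Integrable f) (h w : V) :
    𝓕 (fun x => f (x + h) - f x) w = (((𝐞 (⟪h, w⟫)) : ℂ) - 1) • 𝓕 f w := by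
  have hi1 : Integrable (fun v : V => 𝐞 (-⟪v, w⟫) • f (v + h)) :=
    (Real.fourierIntegral_convergent_iff w).2 (hf.comp_add_right h)
  have hi2 : Integrable (fun v : V => 𝐞 (-⟪v, w⟫) • f v) :=
    (Real.fourierIntegral_convergent_iff w).2 hf
  rw [sub_smul, one_smul, ← fourier_translate f h w, Real.fourier_eq, Real.fourier_eq,
    Real.fourier_eq, ← integral_sub hi1 hi2]
  refine integral_congr_ae (Eventually.of_forall fun v => ?_)
  simp only [smul_sub]

omit [CompleteSpace E] in
/-- `𝓕(t⁻¹(f(· + te) - f))(w) = t⁻¹(e^{2πit⟨e,w⟩} - 1) 𝓕f(w)` for integrable `f`. [folklore] -/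
theorem fourier_diffQuot {f : V → E} (hf : Integrable f) (e w : V) (t : ℝ) :
    𝓕 (fun x => (t⁻¹ : ℝ) • (f (x + t • e) - f x)) w =
      ((t⁻¹ : ℝ) • ((((𝐞 (t * ⟪e, w⟫)) : ℂ)) - 1)) • 𝓕 f w := by
  rw [show (fun v => (t⁻¹ : ℝ) • (f (v + t • e) - f v)) =
      (t⁻¹ : ℝ) • (fun v => f (v + t • e) - f v) from rfl, Real.fourier_eq]
  simp only [Pi.smul_apply, smul_comm _ (t⁻¹ : ℝ), integral_smul]
  rw [← Real.fourier_eq, fourier_translate_sub hf, real_inner_smul_left, smul_assoc]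

omit [CompleteSpace E] in
/-- `w ↦ ‖𝓕f(w)‖ₑ²` is measurable for integrable `f` (`𝓕f` is continuous). [folklore] -/
theorem measurable_enorm_fourier_sq {f : V → E} (h1 : Integrable f) :
    Measurable fun w => ‖𝓕 f w‖ₑ ^ 2 :=
  (continuous_enorm.comp (VectorFourier.fourierIntegral_continuous Real.continuous_fourierChar
    (innerSL ℝ).continuous₂ h1)).measurable.pow_const _

omit [InnerProductSpace ℝ V] [FiniteDimensional ℝ V] [BorelSpace V] in
/-- Measurability of the squared symbol `w ↦ ‖e^{2πit⟨e,w⟩} - 1‖ₑ²` type functions: any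
continuous complex function of `w` has measurable `‖·‖ₑ²`. [folklore] -/
theorem measurable_enorm_sq_of_continuous [OpensMeasurableSpace V] {g : V → ℂ}
    (hg : Continuous g) : Measurable fun w => ‖g w‖ₑ ^ 2 :=
  (continuous_enorm.comp hg).measurable.pow_const _

omit [InnerProductSpace ℂ E] [CompleteSpace E] in
/-- Translates of an `L²` function are `L²`. [folklore] -/
theorem memLp_translate {f : V → E} (hf : MemLp f 2 (volume : Measure V)) (h : V) :
    MemLp (fun x => f (x + h)) 2 (volume : Measure V) :=
  hf.comp_measurePreserving (measurePreserving_add_right volume h)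

/-! ### Plancherel for differences of translates -/

/-- **`∫‖f(x+h) - f(x)‖² = ∫|e^{2πi⟨h,p⟩} - 1|²‖𝓕f(p)‖²`** for `f ∈ L¹ ∩ L²` (Plancherel).
[folklore] -/
theorem lintegral_enorm_sq_translate_sub_eq {f : V → E} (h1 : Integrable f) (h2 : MemLp f 2)
    (h : V) :
    ∫⁻ x, ‖f (x + h) - f x‖ₑ ^ 2 =
      ∫⁻ w, ‖((𝐞 (⟪h, w⟫) : ℂ)) - 1‖ₑ ^ 2 * ‖𝓕 f w‖ₑ ^ 2 := by
  have hg1 : Integrable (fun x => f (x + h) - f x) := (h1.comp_add_right h).sub h1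
  have hg2 : MemLp (fun x => f (x + h) - f x) 2 := (memLp_translate h2 h).sub h2
  rw [← Literature.Analysis.FunctionSpaces.lintegral_enorm_sq_fourierIntegral_eq hg1 hg2]
  refine lintegral_congr fun w => ?_
  rw [fourier_translate_sub h1, enorm_smul, mul_pow]

/-- **`∫‖f(x+h) - f(x)‖² ≤ ∫ (2π⟨h,p⟩)²‖𝓕f(p)‖² dp`** for `f ∈ L¹ ∩ L²`: the difference quotient
is dominated by the `H¹` seminorm in the direction `h`. [folklore] -/
theorem lintegral_enorm_sq_translate_sub_le {f : V → E} (h1 : Integrable f) (h2 : MemLp f 2)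
    (h : V) :
    ∫⁻ x, ‖f (x + h) - f x‖ₑ ^ 2 ≤
      ∫⁻ w, ENNReal.ofReal ((2 * Real.pi * ⟪h, w⟫) ^ 2) * ‖𝓕 f w‖ₑ ^ 2 := by
  rw [lintegral_enorm_sq_translate_sub_eq h1 h2]
  exact lintegral_mono fun w => mul_le_mul_left (enorm_fourierChar_sub_one_sq_le _) _

/-- The same along a line: `∫‖f(x+te) - f(x)‖² ≤ t² ∫ (2π⟨e,p⟩)²‖𝓕f(p)‖²`. [folklore] -/
theorem lintegral_enorm_sq_translate_smul_sub_le {f : V → E} (h1 : Integrable f) (h2 : MemLp f 2)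
    (e : V) (t : ℝ) :
    ∫⁻ x, ‖f (x + t • e) - f x‖ₑ ^ 2 ≤
      ENNReal.ofReal (t ^ 2) * ∫⁻ w, ENNReal.ofReal ((2 * Real.pi * ⟪e, w⟫) ^ 2) * ‖𝓕 f w‖ₑ ^ 2 := by
  refine (lintegral_enorm_sq_translate_sub_le h1 h2 (t • e)).trans (le_of_eq ?_)
  rw [← lintegral_const_mul' _ _ ENNReal.ofReal_ne_top]
  refine lintegral_congr fun w => ?_
  rw [← mul_assoc, ← ENNReal.ofReal_mul (sq_nonneg _), real_inner_smul_left]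
  congr 2
  ring

/-! ### Continuity of translation in `L²` -/

/-- **Translation is continuous in `L²`**: `∫‖f(x+h) - f(x)‖² → 0` as `h → 0`, for `f ∈ L¹ ∩ L²`
(dominated convergence in Fourier space). [folklore] -/
theorem tendsto_lintegral_enorm_sq_translate_sub {f : V → E} (h1 : Integrable f) (h2 : MemLp f 2) :
    Tendsto (fun h : V => ∫⁻ x, ‖f (x + h) - f x‖ₑ ^ 2) (𝓝 0) (𝓝 0) := by
  simp_rw [lintegral_enorm_sq_translate_sub_eq h1 h2]
  have hFm := measurable_enorm_fourier_sq h1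
  have hlim0 : (0 : ℝ≥0∞) = ∫⁻ w : V, ‖((𝐞 (⟪(0 : V), w⟫) : ℂ)) - 1‖ₑ ^ 2 * ‖𝓕 f w‖ₑ ^ 2 := by
    simp
  rw [hlim0]
  refine tendsto_lintegral_filter_of_dominated_convergence (fun w => 4 * ‖𝓕 f w‖ₑ ^ 2)
    (Eventually.of_forall fun h => ?_) (Eventually.of_forall fun h => ae_of_all _ fun w => ?_) ?_
    (ae_of_all _ fun w => ?_)
  · refine Measurable.mul (measurable_enorm_sq_of_continuous ?_) hFm
    exact (continuous_subtype_val.comp (Real.continuous_fourierChar.comp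
      (continuous_const.inner continuous_id))).sub continuous_const
  · exact mul_le_mul_left (enorm_fourierChar_sub_one_sq_le_four _) _
  · rw [lintegral_const_mul _ hFm,
      Literature.Analysis.FunctionSpaces.lintegral_enorm_sq_fourierIntegral_eq h1 h2]
    exact ENNReal.mul_ne_top (by norm_num) (lintegral_enorm_sq_lt_top_of_memLp h2).ne
  · have hφ : Continuous fun h : V => (((𝐞 (⟪h, w⟫)) : ℂ)) - 1 :=
      (continuous_subtype_val.comp (Real.continuous_fourierChar.comp
        (continuous_id.inner continuous_const))).sub continuous_const
    have hc : Continuous fun h : V => ‖((𝐞 (⟪h, w⟫) : ℂ)) - 1‖ₑ ^ 2 * ‖𝓕 f w‖ₑ ^ 2 :=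
      (ENNReal.continuous_mul_const (ENNReal.pow_ne_top enorm_ne_top)).comp
        ((ENNReal.continuous_pow 2).comp (continuous_enorm.comp hφ))
    exact hc.tendsto 0

/-! ### The `H¹` seminorm as a limit of difference quotients (Fatou) -/

/-- The symbol of the difference quotient converges to the symbol of the derivative:
`t⁻¹(e^{2πitθ} - 1) → 2πiθ` as `t → 0`. [folklore] -/
theorem tendsto_inv_smul_fourierChar_sub_one (θ : ℝ) :
    Tendsto (fun t : ℝ => (t⁻¹ : ℝ) • (((𝐞 (t * θ) : ℂ)) - 1)) (𝓝[≠] 0)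
      (𝓝 (2 * Real.pi * Complex.I * θ)) := by
  have hd : HasDerivAt (fun t : ℝ => ((𝐞 (t * θ) : ℂ))) (2 * Real.pi * Complex.I * θ) 0 := by
    have h1 : HasDerivAt (fun x : ℝ => ((𝐞 x : ℂ))) (2 * Real.pi * Complex.I * 𝐞 ((fun t : ℝ => t * θ) 0))
        ((fun t : ℝ => t * θ) 0) := Real.hasDerivAt_fourierChar _
    have h2 := h1.scomp (0 : ℝ) (hasDerivAt_mul_const θ)
    simp only [zero_mul, AddChar.map_zero_eq_one, Circle.coe_one, mul_one, Function.comp_def] at h2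
    refine h2.congr_deriv ?_
    rw [Complex.real_smul]
    ring
  have h := (hasDerivAt_iff_tendsto_slope_zero.1 hd)
  simp only [zero_add, zero_mul, AddChar.map_zero_eq_one, Circle.coe_one] at h
  exact h

/-- Pointwise convergence of the squared symbols: `‖e^{2πitθ} - 1‖²/t² → (2πθ)²`. [folklore] -/
theorem tendsto_enorm_sq_fourierChar_sub_one_div (θ : ℝ) :
    Tendsto (fun t : ℝ => (ENNReal.ofReal (t ^ 2))⁻¹ * ‖((𝐞 (t * θ) : ℂ)) - 1‖ₑ ^ 2) (𝓝[≠] 0)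
      (𝓝 (ENNReal.ofReal ((2 * Real.pi * θ) ^ 2))) := by
  have h := (tendsto_inv_smul_fourierChar_sub_one θ).enorm
  have h2 := (ENNReal.continuous_pow 2).continuousAt.tendsto.comp h
  have hlim : ‖(2 * Real.pi * Complex.I * θ : ℂ)‖ₑ ^ 2 = ENNReal.ofReal ((2 * Real.pi * θ) ^ 2) := by
    rw [← ofReal_norm, ← ENNReal.ofReal_pow (norm_nonneg _)]
    congr 1
    simp only [norm_mul, Complex.norm_real, Real.norm_eq_abs, Complex.norm_I, mul_one,
      Complex.norm_ofNat]
    rw [abs_of_pos Real.pi_pos, mul_pow (2 * Real.pi) |θ|, sq_abs, ← mul_pow]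
  rw [← hlim]
  refine h2.congr' ?_
  filter_upwards [self_mem_nhdsWithin] with t ht
  have ht' : t ≠ 0 := ht
  simp only [Function.comp_apply]
  exact enorm_inv_smul_sq ht' _

/-- **Fatou for difference quotients**: if `t⁻²∫‖f(x+te) - f(x)‖² ≤ L + ε` for all small
`t ≠ 0` and every `ε > 0`, then `∫ (2π⟨e,p⟩)²‖𝓕f(p)‖² dp ≤ L` (`f ∈ L¹ ∩ L²`). Together with
`lintegral_enorm_sq_translate_smul_sub_le` this identifies the `H¹` seminorm of `f` in the
direction `e` with `lim_{t→0} t⁻²‖f(·+te) - f‖₂²` (Lieb–Loss, Thm. 7.9). [folklore] -/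
theorem lintegral_sq_inner_mul_fourier_le_of_eventually {f : V → E} (h1 : Integrable f)
    (h2 : MemLp f 2) (e : V) {L : ℝ≥0∞}
    (hL : ∀ ε : ℝ≥0, 0 < ε → ∀ᶠ t : ℝ in 𝓝[≠] 0,
      ∫⁻ x, ‖f (x + t • e) - f x‖ₑ ^ 2 ≤ ENNReal.ofReal (t ^ 2) * (L + ε)) :
    ∫⁻ w, ENNReal.ofReal ((2 * Real.pi * ⟪e, w⟫) ^ 2) * ‖𝓕 f w‖ₑ ^ 2 ≤ L := by
  have hFm := measurable_enorm_fourier_sq h1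
  refine ENNReal.le_of_forall_pos_le_add fun ε hε _ => ?_
  -- the difference quotients in Fourier space
  set G : ℝ → V → ℝ≥0∞ := fun t w =>
    (ENNReal.ofReal (t ^ 2))⁻¹ * ‖((𝐞 (t * ⟪e, w⟫) : ℂ)) - 1‖ₑ ^ 2 * ‖𝓕 f w‖ₑ ^ 2 with hG
  have hGm : ∀ t, Measurable (G t) := by
    intro t
    refine Measurable.mul (Measurable.mul measurable_const (measurable_enorm_sq_of_continuous ?_)) hFm
    exact (continuous_subtype_val.comp (Real.continuous_fourierChar.comp
      (continuous_const.mul (continuous_const.inner continuous_id)))).sub continuous_const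
  -- pointwise limit
  have hlim : ∀ w, Tendsto (fun t => G t w) (𝓝[≠] 0)
      (𝓝 (ENNReal.ofReal ((2 * Real.pi * ⟪e, w⟫) ^ 2) * ‖𝓕 f w‖ₑ ^ 2)) := fun w =>
    ENNReal.Tendsto.mul_const (tendsto_enorm_sq_fourierChar_sub_one_div _)
      (Or.inr (ENNReal.pow_ne_top enorm_ne_top))
  calc ∫⁻ w, ENNReal.ofReal ((2 * Real.pi * ⟪e, w⟫) ^ 2) * ‖𝓕 f w‖ₑ ^ 2
      = ∫⁻ w, liminf (fun t => G t w) (𝓝[≠] 0) :=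
        lintegral_congr fun w => ((hlim w).liminf_eq).symm
    _ ≤ liminf (fun t => ∫⁻ w, G t w) (𝓝[≠] 0) := lintegral_liminf_le hGm
    _ ≤ L + ε := by
        refine liminf_le_of_frequently_le' (Eventually.frequently ?_)
        filter_upwards [hL ε hε, self_mem_nhdsWithin] with t ht ht0
        have ht0'' : t ≠ 0 := ht0
        have ht0' : ENNReal.ofReal (t ^ 2) ≠ 0 := by
          rw [ne_eq, ENNReal.ofReal_eq_zero, not_le]
          positivity
        have hint : ∫⁻ w, G t w = (ENNReal.ofReal (t ^ 2))⁻¹ * ∫⁻ x, ‖f (x + t • e) - f x‖ₑ ^ 2 := by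
          rw [lintegral_enorm_sq_translate_sub_eq h1 h2,
            ← lintegral_const_mul' _ _ (ENNReal.inv_ne_top.2 ht0')]
          refine lintegral_congr fun w => ?_
          simp only [hG, real_inner_smul_left, mul_assoc]
        rw [hint]
        calc (ENNReal.ofReal (t ^ 2))⁻¹ * ∫⁻ x, ‖f (x + t • e) - f x‖ₑ ^ 2
            ≤ (ENNReal.ofReal (t ^ 2))⁻¹ * (ENNReal.ofReal (t ^ 2) * (L + ε)) :=
              mul_le_mul_right ht _
          _ = L + ε := by
              rw [← mul_assoc, ENNReal.inv_mul_cancel ht0' ENNReal.ofReal_ne_top, one_mul]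

/-! ### The Cauchy property of difference quotients in `L²` -/

omit [CompleteSpace E] in
/-- The symbol defect `A(t) = ∫ |t⁻¹(e^{2πit⟨e,p⟩} - 1) - 2πi⟨e,p⟩|² ‖𝓕f(p)‖² dp` of the
difference quotient in the direction `e` tends to `0` as `t → 0`, provided
`∫ (2π⟨e,p⟩)²‖𝓕f(p)‖² dp < ∞` (dominated convergence; this is the convergence
`t⁻¹(f(·+te) - f) → ∂ₑf` in `L²` read in Fourier space). [folklore] -/
theorem tendsto_lintegral_symbolDefect {f : V → E} (h1 : Integrable f) (e : V)
    (hJ : ∫⁻ w, ENNReal.ofReal ((2 * Real.pi * ⟪e, w⟫) ^ 2) * ‖𝓕 f w‖ₑ ^ 2 ≠ ⊤) :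
    Tendsto (fun t : ℝ => ∫⁻ w,
        ‖(t⁻¹ : ℝ) • ((((𝐞 (t * ⟪e, w⟫)) : ℂ)) - 1) - 2 * Real.pi * Complex.I * ⟪e, w⟫‖ₑ ^ 2 *
          ‖𝓕 f w‖ₑ ^ 2) (𝓝[≠] 0) (𝓝 0) := by
  have hFm := measurable_enorm_fourier_sq h1
  have hsymb : ∀ t : ℝ, Continuous fun w : V =>
      (t⁻¹ : ℝ) • ((((𝐞 (t * ⟪e, w⟫)) : ℂ)) - 1) - 2 * Real.pi * Complex.I * ⟪e, w⟫ := by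
    intro t
    have hφ : Continuous fun w : V => (((𝐞 (t * ⟪e, w⟫)) : ℂ)) - 1 :=
      (continuous_subtype_val.comp (Real.continuous_fourierChar.comp
        (continuous_const.mul (continuous_const.inner continuous_id)))).sub continuous_const
    exact (hφ.const_smul (t⁻¹ : ℝ)).sub (continuous_const.mul (Complex.continuous_ofReal.comp
        (continuous_const.inner continuous_id)))
  have hlim0 : (0 : ℝ≥0∞) = ∫⁻ _w : V, (0 : ℝ≥0∞) := by simp
  rw [hlim0]
  refine tendsto_lintegral_filter_of_dominated_convergence
    (fun w => 4 * (ENNReal.ofReal ((2 * Real.pi * ⟪e, w⟫) ^ 2) * ‖𝓕 f w‖ₑ ^ 2))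
    (Eventually.of_forall fun t => (measurable_enorm_sq_of_continuous (hsymb t)).mul hFm) ?_ ?_
    (ae_of_all _ fun w => ?_)
  · filter_upwards [self_mem_nhdsWithin] with t ht
    refine ae_of_all _ fun w => ?_
    rw [← mul_assoc]
    refine mul_le_mul_left ?_ _
    have ht0 : (t : ℝ) ≠ 0 := ht
    -- `‖t⁻¹(𝐞 - 1)‖ ≤ 2π|θ|` and `‖2πiθ‖ = 2π|θ|`
    have hb1 : ‖(t⁻¹ : ℝ) • ((((𝐞 (t * ⟪e, w⟫)) : ℂ)) - 1)‖ ≤ 2 * Real.pi * |⟪e, w⟫| := by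
      rw [norm_smul, Real.norm_eq_abs, abs_inv]
      calc |t|⁻¹ * ‖(((𝐞 (t * ⟪e, w⟫)) : ℂ)) - 1‖ ≤ |t|⁻¹ * (2 * Real.pi * |t * ⟪e, w⟫|) :=
            mul_le_mul_of_nonneg_left (norm_fourierChar_sub_one_le _) (by positivity)
        _ = 2 * Real.pi * |⟪e, w⟫| := by
            rw [abs_mul]; field_simp
    have hb2 : ‖(2 * Real.pi * Complex.I * ⟪e, w⟫ : ℂ)‖ = 2 * Real.pi * |⟪e, w⟫| := by
      simp only [norm_mul, Complex.norm_real, Real.norm_eq_abs, Complex.norm_I, mul_one,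
        Complex.norm_ofNat, abs_of_pos Real.pi_pos]
    have hb : ‖(t⁻¹ : ℝ) • ((((𝐞 (t * ⟪e, w⟫)) : ℂ)) - 1) - 2 * Real.pi * Complex.I * ⟪e, w⟫‖ ≤
        2 * (2 * Real.pi * |⟪e, w⟫|) := by
      refine (norm_sub_le _ _).trans ?_
      rw [hb2, two_mul (2 * Real.pi * |⟪e, w⟫|)]
      exact add_le_add_left hb1 _
    rw [← ofReal_norm, ← ENNReal.ofReal_pow (norm_nonneg _),
      show (4 : ℝ≥0∞) = ENNReal.ofReal 4 by norm_num, ← ENNReal.ofReal_mul (by norm_num)]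
    refine ENNReal.ofReal_le_ofReal ?_
    calc _ ≤ (2 * (2 * Real.pi * |⟪e, w⟫|)) ^ 2 := pow_le_pow_left₀ (norm_nonneg _) hb 2
      _ = 4 * (2 * Real.pi * ⟪e, w⟫) ^ 2 := by
          rw [mul_pow, mul_pow (2 * Real.pi) |⟪e, w⟫|, sq_abs, ← mul_pow]; norm_num
  · have hm : Measurable fun w : V => ENNReal.ofReal ((2 * Real.pi * ⟪e, w⟫) ^ 2) * ‖𝓕 f w‖ₑ ^ 2 :=
      (ENNReal.measurable_ofReal.comp
        ((continuous_const.mul (continuous_const.inner continuous_id)).pow 2).measurable).mul hFm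
    rw [lintegral_const_mul _ hm]
    exact ENNReal.mul_ne_top (by norm_num) hJ
  · have h := ((tendsto_inv_smul_fourierChar_sub_one ⟪e, w⟫).sub_const
      (2 * Real.pi * Complex.I * ⟪e, w⟫)).enorm
    rw [sub_self, enorm_zero] at h
    have h2 := ((ENNReal.continuous_pow 2).continuousAt.tendsto.comp h)
    simp only [Function.comp_def, ne_eq, OfNat.ofNat_ne_zero, not_false_eq_true, zero_pow] at h2
    have h3 := ENNReal.Tendsto.mul_const (b := ‖𝓕 f w‖ₑ ^ 2) h2
      (Or.inr (ENNReal.pow_ne_top enorm_ne_top))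
    rw [zero_mul] at h3
    exact h3

/-- **Difference quotients are Cauchy in `L²`, quantitatively**: for all `s, t`,
`∫‖t⁻¹(f(x+te) - f(x)) - s⁻¹(f(x+se) - f(x))‖² ≤ 2A(t) + 2A(s)` with the symbol defect `A` of
`tendsto_lintegral_symbolDefect` (Plancherel). [folklore] -/
theorem lintegral_enorm_sq_diffQuot_sub_le {f : V → E} (h1 : Integrable f) (h2 : MemLp f 2)
    (e : V) (s t : ℝ) :
    ∫⁻ x, ‖(t⁻¹ : ℝ) • (f (x + t • e) - f x) - (s⁻¹ : ℝ) • (f (x + s • e) - f x)‖ₑ ^ 2 ≤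
      2 * (∫⁻ w, ‖(t⁻¹ : ℝ) • ((((𝐞 (t * ⟪e, w⟫)) : ℂ)) - 1) -
              2 * Real.pi * Complex.I * ⟪e, w⟫‖ₑ ^ 2 * ‖𝓕 f w‖ₑ ^ 2) +
        2 * (∫⁻ w, ‖(s⁻¹ : ℝ) • ((((𝐞 (s * ⟪e, w⟫)) : ℂ)) - 1) -
              2 * Real.pi * Complex.I * ⟪e, w⟫‖ₑ ^ 2 * ‖𝓕 f w‖ₑ ^ 2) := by
  -- the function and its Fourier transform
  set g : V → E := fun x => (t⁻¹ : ℝ) • (f (x + t • e) - f x) - (s⁻¹ : ℝ) • (f (x + s • e) - f x)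
    with hg
  have hgt1 : Integrable (fun x => f (x + t • e) - f x) := (h1.comp_add_right _).sub h1
  have hgs1 : Integrable (fun x => f (x + s • e) - f x) := (h1.comp_add_right _).sub h1
  have hg1 : Integrable g := (hgt1.smul (t⁻¹ : ℝ)).sub (hgs1.smul (s⁻¹ : ℝ))
  have hg2 : MemLp g 2 :=
    (((memLp_translate h2 _).sub h2).const_smul _).sub (((memLp_translate h2 _).sub h2).const_smul _)
  have hFg : ∀ w, 𝓕 g w = ((t⁻¹ : ℝ) • ((((𝐞 (t * ⟪e, w⟫)) : ℂ)) - 1) -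
      (s⁻¹ : ℝ) • ((((𝐞 (s * ⟪e, w⟫)) : ℂ)) - 1)) • 𝓕 f w := by
    intro w
    have hit : Integrable (fun v : V => 𝐞 (-⟪v, w⟫) • ((t⁻¹ : ℝ) • (f (v + t • e) - f v))) :=
      (Real.fourierIntegral_convergent_iff w).2 (hgt1.smul (t⁻¹ : ℝ))
    have his : Integrable (fun v : V => 𝐞 (-⟪v, w⟫) • ((s⁻¹ : ℝ) • (f (v + s • e) - f v))) :=
      (Real.fourierIntegral_convergent_iff w).2 (hgs1.smul (s⁻¹ : ℝ))
    rw [sub_smul, ← fourier_diffQuot h1 e w t, ← fourier_diffQuot h1 e w s, hg, Real.fourier_eq,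
      Real.fourier_eq, Real.fourier_eq, ← integral_sub hit his]
    refine integral_congr_ae (Eventually.of_forall fun v => ?_)
    simp only [smul_sub]
  rw [← Literature.Analysis.FunctionSpaces.lintegral_enorm_sq_fourierIntegral_eq hg1 hg2]
  simp_rw [hFg, enorm_smul, mul_pow]
  -- `‖a - b‖² ≤ 2‖a - c‖² + 2‖b - c‖²`
  have hFm := measurable_enorm_fourier_sq h1
  have hsymb : ∀ r : ℝ, Continuous fun w : V =>
      (r⁻¹ : ℝ) • ((((𝐞 (r * ⟪e, w⟫)) : ℂ)) - 1) - 2 * Real.pi * Complex.I * ⟪e, w⟫ := by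
    intro r
    have hφ : Continuous fun w : V => (((𝐞 (r * ⟪e, w⟫)) : ℂ)) - 1 :=
      (continuous_subtype_val.comp (Real.continuous_fourierChar.comp
        (continuous_const.mul (continuous_const.inner continuous_id)))).sub continuous_const
    exact (hφ.const_smul (r⁻¹ : ℝ)).sub (continuous_const.mul (Complex.continuous_ofReal.comp
        (continuous_const.inner continuous_id)))
  have hm1 : Measurable fun w : V => ‖(t⁻¹ : ℝ) • ((((𝐞 (t * ⟪e, w⟫)) : ℂ)) - 1) -
      2 * Real.pi * Complex.I * ⟪e, w⟫‖ₑ ^ 2 * ‖𝓕 f w‖ₑ ^ 2 :=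
    (measurable_enorm_sq_of_continuous (hsymb t)).mul hFm
  have hm2 : Measurable fun w : V => ‖(s⁻¹ : ℝ) • ((((𝐞 (s * ⟪e, w⟫)) : ℂ)) - 1) -
      2 * Real.pi * Complex.I * ⟪e, w⟫‖ₑ ^ 2 * ‖𝓕 f w‖ₑ ^ 2 :=
    (measurable_enorm_sq_of_continuous (hsymb s)).mul hFm
  rw [← lintegral_const_mul _ hm1, ← lintegral_const_mul _ hm2,
    ← lintegral_add_left (hm1.const_mul _)]
  refine lintegral_mono fun w => ?_
  rw [← mul_assoc, ← mul_assoc, ← add_mul]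
  exact mul_le_mul_left (enorm_sub_sq_le_two_mul _ _ _) _

end Literature.MathematicalPhysics.QuantumManyBody.BoseGas

end
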